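import Mathlib
import Literature.NumberTheory.NumberFields.DegreeOnePrimes
import Summits.MatrixMultiplication.MatrixMultiplication.Theorems.LevelGradedCohnUmansLevelOneGL2DesignsTraceZeroLiftBoxes

/-!
# The abstract trace-zero parabola lift, III: the exponent `3/2 - 1/[K:ℚ]` for every totally real
field of degree `≥ 3` (crux `LevelOneGL2Designs`, stmt-MatrixMultiplication-14080, wall stub
`stub_tangencySets`; wall-breaker axis k8/12 "parabola lifts over finite fields")

From the box form `TraceZeroLift.traceZeroLift_boxes` (`∃ C = C(K) > 0`: `C·M^{2d} < p ⇒` an SRS of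
`AG(2,p)` with `(2M+1)^d (2M²+1)^{d-1} ≤ |S| + p`) to the power bound, with the parameter choice of
Pohoata's proof of Thm. 1.3: `M = ⌊y⌋`, `y = (p/2C)^{1/(2d)}`, so that the window holds with room
to spare, `M^{3d-2} ≥ (y/2)^{3d-2} = 2c · p^{3/2 - 1/d}`, and the `- p` (flags through the origin)
is absorbed once `p^{1/2 - 1/d} ≥ 1/c`, which needs `d ≥ 3`.

* `traceZeroLift_exponent` : `K` totally real, `[K:ℚ] = d ≥ 3 ⇒ ∃ c > 0, ∃ p₁, ∀ primes p ≥ p₁,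
  ∀ φ : 𝓞 K →+* ZMod p,` an SRS in the format of `stub_tangencySets` with `c · p^{3/2 - 1/d} ≤ |S|`;
* `stubFormat_of_totallyReal` : the stub's exact quantifier shape (`∃ c > 0, ∀ p₀, ∃ prime p ≥ p₀, …`)
  at exponent `3/2 - 1/d` for EVERY totally real `K` of degree `d ≥ 3` (degree-one primes exist above
  infinitely many `p`: `Literature.NumberTheory.NumberFields.exists_prime_gt_nonempty_ringHom_zmod`).

This is Proposition 5.1 of Pohoata (arXiv:2607.20422) for an arbitrary totally real field; the
hypothesis "`p` has a prime of residue degree one in `K`" is exactly the existence of `φ`.  Feeding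
in families of fields with many such primes recovers the tree's explicit instances (cyclotomic
`ℚ(ζ_r)⁺`, `p ≡ 1 (mod r)`: `CyclotomicLift.cyclotomicLift_uniform`; multiquadratic fields: all
primes, `Multiquadratic.exists_tangencySet_allPrimes`).  None of this reaches exponent `3/2`.

References: C. Pohoata, arXiv:2607.20422 (2026), Prop. 5.1, proof of Thm. 1.3
[bib: Pohoata2026SharpExponentMinimalDistance].
-/

-- justification: the summit/problem path `MatrixMultiplication.MatrixMultiplication` is fixed by the
-- tree layout (D-0017), so the namespace necessarily repeats a component.
set_option linter.dupNamespace false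

noncomputable section

open NumberField Module Finset Matrix

namespace Summit.MatrixMultiplication.MatrixMultiplication.Theorems.LevelOneGL2Designs.TraceZeroLift

variable (K : Type*) [Field K] [NumberField K]

/-- Elementary count: `M^{3d-2} ≤ (2M+1)^d (2M²+1)^{d-1}` (`d ≥ 1`). -/
theorem pow_le_boxCount (M d : ℕ) (hd : 1 ≤ d) :
    M ^ (3 * d - 2) ≤ (2 * M + 1) ^ d * (2 * M ^ 2 + 1) ^ (d - 1) := by
  have h1 : M ^ d ≤ (2 * M + 1) ^ d := Nat.pow_le_pow_left (by omega) _
  have h2 : (M ^ 2) ^ (d - 1) ≤ (2 * M ^ 2 + 1) ^ (d - 1) := Nat.pow_le_pow_left (by omega) _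
  calc M ^ (3 * d - 2) = M ^ d * (M ^ 2) ^ (d - 1) := by
        rw [← pow_mul, ← pow_add]; congr 1; omega
    _ ≤ (2 * M + 1) ^ d * (2 * M ^ 2 + 1) ^ (d - 1) := Nat.mul_le_mul h1 h2

/-- **Pohoata's Proposition 5.1 for an arbitrary totally real field — the exponent
`3/2 - 1/[K:ℚ]`.**  Let `K` be totally real of degree `d ≥ 3`.  There are `c = c(K) > 0` and `p₁`
such that for every prime `p ≥ p₁` possessing a prime of `K` of residue degree one above it (a
ring map `𝓞 K → ZMod p`), the affine plane over `ZMod p` carries a strong representative system in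
the format of `stub_tangencySets` with at least `c · p^{3/2 - 1/d}` flags (`M = ⌊(p/2C)^{1/(2d)}⌋`
in `traceZeroLift_boxes`).  For `d = 2` the exponent is `1` and the statement is void; `d → ∞`
along any family of totally real fields in which `p` has a degree-one prime recovers every
exponent `< 3/2` (cyclotomic `ℚ(ζ_r)⁺`: Pohoata's Thm. 1.3; multiquadratic fields: all primes).
[cite: Pohoata2026SharpExponentMinimalDistance, Proposition 5.1 and proof of Theorem 1.3] -/
theorem traceZeroLift_exponent (K : Type*) [Field K] [NumberField K] [IsTotallyReal K]
    (hd : 3 ≤ Module.finrank ℚ K) :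
    ∃ c : ℝ, 0 < c ∧ ∃ p₁ : ℕ, ∀ (p : ℕ) [Fact p.Prime], p₁ ≤ p → ∀ _φ : 𝓞 K →+* ZMod p,
      ∃ S : Finset ((Fin 2 → ZMod p) × (Fin 2 → ZMod p)),
        c * (p : ℝ) ^ ((3 : ℝ) / 2 - 1 / Module.finrank ℚ K) ≤ S.card ∧
        ∀ f ∈ S, ∀ f' ∈ S, (dotProduct f.1 f'.2 = 1 ↔ f = f') := by
  obtain ⟨C, hC, hcons⟩ := traceZeroLift_boxes K
  set d := finrank ℚ K with hd_def
  -- constants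
  set A : ℝ := 2 * C with hA
  have hA0 : 0 < A := by positivity
  have hd0 : (0 : ℝ) < d := by exact_mod_cast (show 0 < d by omega)
  set θ : ℝ := 1 / (2 * d) with hθ
  set e : ℝ := (3 : ℝ) / 2 - 1 / d with he
  have hθe : θ * ((3 * d - 2 : ℕ) : ℝ) = e := by
    rw [hθ, he, Nat.cast_sub (by omega)]
    push_cast
    field_simp
  have he1 : 0 < e - 1 := by
    rw [he]
    have : (1 : ℝ) / d ≤ 1 / 3 :=
      one_div_le_one_div_of_le (by norm_num : (0 : ℝ) < 3) (by exact_mod_cast hd)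
    linarith
  set c : ℝ := 1 / (2 * (A ^ e * 2 ^ (3 * d - 2))) with hc
  have hc0 : 0 < c := by positivity
  set P : ℝ := (1 / c) ^ (1 / (e - 1)) with hP
  refine ⟨c, hc0, max ⌈A * (2 : ℝ) ^ (2 * d)⌉₊ ⌈P⌉₊, fun p hp hp₁ φ => ?_⟩
  have hp0 : (0 : ℝ) < p := by exact_mod_cast hp.out.pos
  have hp₁' : (⌈A * (2 : ℝ) ^ (2 * d)⌉₊ : ℝ) ≤ p := by exact_mod_cast (le_max_left _ _).trans hp₁
  have hp₂' : (⌈P⌉₊ : ℝ) ≤ p := by exact_mod_cast (le_max_right _ _).trans hp₁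
  -- the real parameter `y = (p/A)^{1/(2d)}` and `M = ⌊y⌋`
  set y : ℝ := ((p : ℝ) / A) ^ θ with hy
  have hy0 : 0 ≤ y := Real.rpow_nonneg (by positivity) _
  have hy_pow : y ^ (2 * d) = (p : ℝ) / A := by
    rw [hy, ← Real.rpow_natCast, ← Real.rpow_mul (by positivity), hθ]
    rw [show (1 : ℝ) / (2 * d) * ((2 * d : ℕ) : ℝ) = 1 by push_cast; field_simp]
    exact Real.rpow_one _
  have hy_pow' : y ^ (3 * d - 2) = (p : ℝ) ^ e / A ^ e := by
    rw [hy, ← Real.rpow_natCast, ← Real.rpow_mul (by positivity), hθe,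
      Real.div_rpow hp0.le hA0.le]
  have hy2 : 2 ≤ y := by
    have hpA : A * (2 : ℝ) ^ (2 * d) ≤ p := (Nat.le_ceil _).trans hp₁'
    have h2d : (2 : ℝ) ^ (2 * d) ≤ y ^ (2 * d) := by
      rw [hy_pow, le_div_iff₀ hA0]; linarith
    by_contra hlt
    rw [not_le] at hlt
    have : y ^ (2 * d) < (2 : ℝ) ^ (2 * d) := pow_lt_pow_left₀ hlt hy0 (by omega)
    linarith
  set M : ℕ := ⌊y⌋₊ with hM
  have hMle : (M : ℝ) ≤ y := Nat.floor_le hy0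
  have hMgt : y < M + 1 := Nat.lt_floor_add_one y
  have hMy : y / 2 ≤ M := by linarith
  -- the window `C M^{2d} < p`
  have hMp : C * (M : ℝ) ^ (2 * d) < p := by
    have h1 : C * (M : ℝ) ^ (2 * d) ≤ p / 2 := by
      calc C * (M : ℝ) ^ (2 * d) ≤ C * y ^ (2 * d) := by gcongr
        _ = C * (p / A) := by rw [hy_pow]
        _ = p / 2 := by rw [hA]; field_simp
    linarith
  -- the construction
  obtain ⟨S, hcount, hprop⟩ := hcons p φ M hMp
  refine ⟨S, ?_, hprop⟩
  have hcnt : M ^ (3 * d - 2) ≤ S.card + p := (pow_le_boxCount M d (by omega)).trans hcount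
  have hcntR : (M : ℝ) ^ (3 * d - 2) ≤ S.card + p := by exact_mod_cast hcnt
  -- `(y/2)^{3d-2} = 2c · p^e`
  have hmain : 2 * c * (p : ℝ) ^ e ≤ S.card + p := by
    calc 2 * c * (p : ℝ) ^ e = (y / 2) ^ (3 * d - 2) := by
          rw [div_pow, hy_pow', hc]
          field_simp
      _ ≤ (M : ℝ) ^ (3 * d - 2) := pow_le_pow_left₀ (by linarith) hMy _
      _ ≤ S.card + p := hcntR
  -- `p ≤ c · p^e` for `p ≥ P`
  have hlarge : (p : ℝ) ≤ c * (p : ℝ) ^ e := by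
    have hPp : P ≤ p := (Nat.le_ceil P).trans hp₂'
    have hP0 : 0 ≤ P := Real.rpow_nonneg (by positivity) _
    have h1 : 1 / c ≤ (p : ℝ) ^ (e - 1) := by
      calc 1 / c = P ^ (e - 1) := by
            rw [hP, ← Real.rpow_mul (by positivity), one_div_mul_cancel he1.ne', Real.rpow_one]
        _ ≤ (p : ℝ) ^ (e - 1) := Real.rpow_le_rpow hP0 hPp he1.le
    have h2 : c * (p : ℝ) ^ e = c * (p : ℝ) ^ (e - 1) * p := by
      rw [show e = (e - 1) + 1 by ring, Real.rpow_add hp0, Real.rpow_one]; ring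
    rw [h2]
    have h3 : 1 ≤ c * (p : ℝ) ^ (e - 1) := by
      rw [div_le_iff₀ hc0] at h1; linarith
    nlinarith
  linarith

/-- **The stub's format at exponent `3/2 - 1/[K:ℚ]` for EVERY totally real field of degree
`d ≥ 3`.**  Combining `traceZeroLift_exponent` with the elementary existence of infinitely many
primes of residue degree one (`Literature.NumberTheory.NumberFields.exists_prime_gt_nonempty_ringHom_zmod`,
Schur's theorem + discriminant scaling): `∃ c > 0, ∀ p₀, ∃ prime p ≥ p₀,` an SRS of `AG(2,p)` in
the exact flag format of `stub_tangencySets` with `c · p^{3/2 - 1/d} ≤ |S|`.  With `d → ∞` over any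
sequence of totally real fields this is the stub at every exponent `< 3/2`; the stub itself
(exponent `3/2`) is not reached by any number-field lift.
[cite: Pohoata2026SharpExponentMinimalDistance, Proposition 5.1 / Theorem 1.3] -/
theorem stubFormat_of_totallyReal (K : Type*) [Field K] [NumberField K] [IsTotallyReal K]
    (hd : 3 ≤ Module.finrank ℚ K) :
    ∃ c : ℝ, 0 < c ∧ ∀ p₀ : ℕ, ∃ (p : ℕ) (_ : Fact p.Prime), p₀ ≤ p ∧
      ∃ S : Finset ((Fin 2 → ZMod p) × (Fin 2 → ZMod p)),
        c * (p : ℝ) ^ ((3 : ℝ) / 2 - 1 / Module.finrank ℚ K) ≤ S.card ∧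
        ∀ f ∈ S, ∀ f' ∈ S, (dotProduct f.1 f'.2 = 1 ↔ f = f') := by
  obtain ⟨c, hc, p₁, h⟩ := traceZeroLift_exponent K hd
  refine ⟨c, hc, fun p₀ => ?_⟩
  obtain ⟨p, hp, hlt, ⟨φ⟩⟩ :=
    Literature.NumberTheory.NumberFields.exists_prime_gt_nonempty_ringHom_zmod K (max p₀ p₁)
  haveI : Fact p.Prime := ⟨hp⟩
  obtain ⟨S, hS, hprop⟩ := h p (le_of_lt (lt_of_le_of_lt (le_max_right _ _) hlt)) φ
  exact ⟨p, ⟨hp⟩, le_of_lt (lt_of_le_of_lt (le_max_left _ _) hlt), S, hS, hprop⟩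

end Summit.MatrixMultiplication.MatrixMultiplication.Theorems.LevelOneGL2Designs.TraceZeroLift
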